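import Mathlib
import Summits.Ventures.PercRepro2.LocRows
import Summits.Ventures.PercRepro2.SwRow
import Summits.Ventures.PercRepro2.SwOut
import Summits.Ventures.PercRepro2.SwAllRow
import Summits.Ventures.PercRepro2.SwOutAll
import Summits.Ventures.PercRepro2.SwOutReducible

/-!
# The rigid inequality of a class from the rigid inequalities of its blocks (blind cell PercRepro2,
night-4 g18, 2026-08-27; proofs/NIGHT4-G18.md §7, item (P3))

`card_filter_le_of_blocks`: if a finite set of configurations is the union of a finite family of
pairwise disjoint blocks and each block satisfies a counting inequality between two filtered
cardinalities, so does the union (the counts add over the blocks: `Finset.card_biUnion`).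
`rigidOK_of_blocks`: hence `RigidOK` of a class that is the disjoint union of blocks each
satisfying the rigid inequality on its intersection with the conditioning.  With
`MixedBase.rigid_block` (`SwOutMixedCoreBlockThm`) this reduces the (SW) row of a class to the
PARTITION of the class into blocks.
-/

namespace Summit.Ventures.PercRepro2

namespace BigBlock

open Hull LocRows

open scoped Classical

variable {V : Type*} {E : Type*}

section Sum

variable {α : Type*} [DecidableEq α] {ι : Type*}

/-- A count over a disjoint union of blocks is the sum of the counts over the blocks. -/
lemma card_filter_biUnion (s : Finset ι) (B : ι → Finset α)
    (hdisj : ∀ i ∈ s, ∀ j ∈ s, i ≠ j → Disjoint (B i) (B j)) (P : α → Prop) :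
    ((s.biUnion B).filter P).card = ∑ i ∈ s, ((B i).filter P).card := by
  rw [Finset.filter_biUnion, Finset.card_biUnion]
  intro i hi j hj hij
  exact Finset.disjoint_filter_filter (hdisj i hi j hj hij)

/-- **Counting inequalities add over disjoint blocks.** -/
theorem card_filter_le_of_blocks (s : Finset ι) (B : ι → Finset α)
    (hdisj : ∀ i ∈ s, ∀ j ∈ s, i ≠ j → Disjoint (B i) (B j)) (P P' : α → Prop)
    (hB : ∀ i ∈ s, ((B i).filter P).card ≤ ((B i).filter P').card) :
    ((s.biUnion B).filter P).card ≤ ((s.biUnion B).filter P').card := by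
  rw [card_filter_biUnion s B hdisj P, card_filter_biUnion s B hdisj P']
  exact Finset.sum_le_sum hB

end Sum

section Rigid

variable [Fintype E] [DecidableEq E] {ends : E → Sym2 V} {l h o : V} {U : Set V} {ξ : Config E}

/-- **`RigidOK` of a class that is the disjoint union of blocks** each satisfying the rigid
inequality on its intersection with the conditioning. -/
theorem rigidOK_of_blocks {ι : Type*} (s : Finset ι) (B : ι → Finset (Config E))
    (hdisj : ∀ i ∈ s, ∀ j ∈ s, i ≠ j → Disjoint (B i) (B j))
    (hcover : swOutSide ends l h o U ξ = s.biUnion B)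
    (hB : ∀ i ∈ s, ∀ 𝓔 : Set (Set E), IsUpperSet 𝓔 →
      ((B i).filter fun ζ => redEdges ends ζ h ∈ 𝓔).card ≤
        ((B i).filter fun ζ => blueEdges ends ζ h ∈ 𝓔).card) :
    RigidOK ends l h o U ξ := by
  intro 𝓔 h𝓔
  rw [hcover]
  exact card_filter_le_of_blocks s B hdisj _ _ (fun i hi => hB i hi 𝓔 h𝓔)

end Rigid

end BigBlock

end Summit.Ventures.PercRepro2
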